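import Literature.NumberTheory.LFunctions.Zhang2022.Section8Certificate
import Literature.Analysis.ValidatedNumerics.BoxCover

/-!
# Zhang (2022) §18-margin repair rung: box-input primitives for parameter covers

Trunk T-ANT (NumberTheory/LFunctions). Infrastructure for the REPAIR-or-BARRIER study of the
failing inequality of record `Skeleton.Margin232` (Y. Zhang, arXiv:2211.02515v1, §18
[Zhang2022LandauSiegel]; refuted at the printed parameters by `Skeleton.not_margin232`,
`Section18AllIota.C232G_ge`). The barrier question asks for a certified lower bound of the margin
functional `𝔠₁ + 𝔠₂ + 2 Re 𝔠₃` over a whole REGION of the manuscript's structural parameters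
(exponent split `ν`, shifts, …), not at one point. The kernel certificates of
`Section8Certificate` / `Section18Certificate` enclose the closed forms of `Section8ClosedForm`
at RATIONAL lengths and frequencies (`expQuadIntB (m L : ℚ)`, `expIpi (θ : ℚ)`,
`overPiFI (q : ℚ)`), while the closed forms themselves are already generic in the real lengths
and shifts (`expQuadInt … (L : ℝ)`, `FGint/FGXint/FGYint … (L s : ℝ)`, `polyInt (L : ℝ)`).
This file supplies the box primitives with every length / shift / frequency an INTERVAL, so that
one box evaluation encloses a closed form uniformly over a parameter box (Moore's inclusion
property; a point certificate is the degenerate case):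

* `invMulPi m = 1/(mπ)` and the real-frequency closed form `expQuadIntR q₀ q₁ q₂ (m L : ℝ)` of
  `∫₀ᴸ (q₀ + q₁z + q₂z²)e^{mπiz} dz` (`integral_quad_mul_cexp_real`, fundamental theorem of
  calculus; `expQuadIntR_ratCast` identifies it with `expQuadInt` at rational `m`);
* interval primitives with `mem` lemmas and validity flags `…OK`: `mulPiFI X ∋ xπ`,
  `scaleRatFI X q ∋ qx`, `recipFI X ∋ 1/x` and `recipMulPiFI X ∋ 1/(xπ)` (either sign),
  `expIpiFI X ∋ e^{xπi}`;
* `mem` lemmas for the antiderivative boxes `P0B`, `P1B`, `P2B`, `PzB` of `Section8Certificate`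
  at REAL arguments, `mem_polyIntB_real`, and two box mirrors of the exponential–quadratic
  integral: `expQuadIntBL (m : ℚ) (L : FI)` (rational frequency, interval length) and
  `expQuadIntBR (M L : FI)` (interval frequency and length), `mem_expQuadIntBL/BR`;
* interval-length/shift mirrors of the §8 integrals with the printed (rational) profiles:
  `FGintBL`, `FGXintBL`, `FGYintBL` (`mem_…`), built on `shiftRBI`, `shiftUBI`;
* `boxFI B i`: coordinate `i` of a rational `Box` (`Literature.Analysis.ValidatedNumerics.Box`,
  the kd-tree cover format of `BoxCover.lean`) as an `FI`, `mem_boxFI`.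

No statement about the manuscript is made here; no facts, no axioms beyond the standard three.
The `mem` lemmas are instances of the inclusion property of interval arithmetic
[R. E. Moore, *Interval Analysis*, Prentice-Hall (1966), Theorem 3.1]; the closed form is calculus
on the printed integrands of [Zhang2022LandauSiegel, §8 (8.13)–(8.22)].
-/

noncomputable section

open Complex Real ComplexConjugate
open Literature.Analysis.ValidatedNumerics.Numerics
open Literature.Analysis.ValidatedNumerics (Box)

namespace Literature.NumberTheory.LFunctions.Zhang2022

/-! ### The real-frequency closed form -/

/-- `1/(mπ)`, the constant `u` of the antiderivative of `(q₀ + q₁z + q₂z²)e^{mπiz}` for a REAL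
frequency `m` (cf. `overPi m⁻¹` for rational `m`). [folklore] -/
def invMulPi (m : ℝ) : ℝ := 1 / (m * π)

/-- At a rational frequency `invMulPi` is `overPi m⁻¹`. [cite: Zhang2022LandauSiegel, §8 (8.13)–(8.22)] -/
theorem invMulPi_ratCast (m : ℚ) : invMulPi (m : ℝ) = overPi m⁻¹ := by
  unfold invMulPi overPi
  push_cast
  ring

/-- `mπ · (1/(mπ)) = 1` for `m ≠ 0`. [cite: Zhang2022LandauSiegel, §8 (8.13)–(8.22)] -/
theorem invMulPi_mul {m : ℝ} (hm : m ≠ 0) : (m : ℂ) * π * ((invMulPi m : ℝ) : ℂ) = 1 := by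
  unfold invMulPi
  have hπ : (π : ℂ) ≠ 0 := by exact_mod_cast Real.pi_ne_zero
  have hm' : (m : ℂ) ≠ 0 := by exact_mod_cast hm
  push_cast
  field_simp

/-- Closed form `P(L)e^{mπiL} − P(0)` of `∫₀ᴸ (q₀ + q₁z + q₂z²)e^{mπiz} dz` for a REAL frequency
`m ≠ 0` (`integral_quad_mul_cexp_real`); same shape as `expQuadInt`. [folklore] -/
def expQuadIntR (q0 q1 q2 : ℂ) (m L : ℝ) : ℂ :=
  Pz q0 q1 q2 (invMulPi m) L * cexp ((((m * L * π : ℝ)) : ℂ) * I) - P0 q0 q1 q2 (invMulPi m)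

/-- At a rational frequency the real-frequency closed form is `expQuadInt`. [cite: Zhang2022LandauSiegel, §8 (8.13)–(8.22)] -/
theorem expQuadIntR_ratCast (q0 q1 q2 : ℂ) (m : ℚ) (L : ℝ) :
    expQuadIntR q0 q1 q2 (m : ℝ) L = expQuadInt q0 q1 q2 m L := by
  unfold expQuadIntR expQuadInt
  rw [invMulPi_ratCast]

/-- `∫₀ᴸ (q₀ + q₁z + q₂z²) e^{mπiz} dz = expQuadIntR q₀ q₁ q₂ m L` for REAL `m ≠ 0`
(fundamental theorem of calculus with the explicit antiderivative `P(z)e^{mπiz}`; the proof of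
`integral_quad_mul_cexp` verbatim with `1/(mπ)` for `overPi m⁻¹`). [cite: Zhang2022LandauSiegel, §8 (8.13)–(8.22)] -/
theorem integral_quad_mul_cexp_real (q0 q1 q2 : ℂ) {m : ℝ} (hm : m ≠ 0) (L : ℝ) :
    ∫ z in (0:ℝ)..L, (q0 + q1 * z + q2 * (z * z)) * cexp (m * π * I * z)
      = expQuadIntR q0 q1 q2 m L := by
  have hu := invMulPi_mul hm
  unfold expQuadIntR
  revert hu
  generalize invMulPi m = u
  intro hu
  have hI : I ^ 2 = -1 := Complex.I_sq
  have hderiv : ∀ z : ℝ, HasDerivAt (fun x : ℝ => Pz q0 q1 q2 u x * cexp (m * π * I * x))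
      ((q0 + q1 * z + q2 * (z * z)) * cexp (m * π * I * z)) z := by
    intro z
    have h1 : HasDerivAt (fun x : ℝ => (x : ℂ)) 1 z := by
      simpa using (hasDerivAt_id z).ofReal_comp
    have hP : HasDerivAt (fun x : ℝ => Pz q0 q1 q2 u x) (P1 q1 q2 u + P2 q2 u * (2 * z)) z := by
      have h := (((h1.const_mul (P1 q1 q2 u)).fun_add ((h1.fun_mul h1).const_mul (P2 q2 u))).const_add
        (P0 q0 q1 q2 u))
      have e : (fun x : ℝ => Pz q0 q1 q2 u x)
          = fun x : ℝ => P0 q0 q1 q2 u + (P1 q1 q2 u * (x : ℂ) + P2 q2 u * ((x : ℂ) * (x : ℂ))) := by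
        funext x; unfold Pz; push_cast; ring
      rw [e]
      exact h.congr_deriv (by ring)
    have hE : HasDerivAt (fun x : ℝ => cexp (m * π * I * x)) (cexp (m * π * I * z) * (m * π * I)) z :=
      ((h1.const_mul ((m : ℂ) * π * I)).cexp).congr_deriv (by ring)
    refine (hP.fun_mul hE).congr_deriv ?_
    unfold Pz P0 P1 P2
    push_cast
    linear_combination
      (cexp (m * π * I * z) * ((q0 + I * u * q1 - 2 * u * u * q2) + (q1 + 2 * I * u * q2) * z
          + q2 * (z * z))) * hu
      + (cexp (m * π * I * z) * (-(m * π * u) * q0 + 2 * (m * π) * u * u * u * q2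
          + (-(m * π * u) * q1) * z + (-(m * π * u) * q2) * (z * z))) * hI
  have hint : IntervalIntegrable (fun z : ℝ => (q0 + q1 * z + q2 * (z * z)) * cexp (m * π * I * z))
      MeasureTheory.volume 0 L :=
    (Continuous.intervalIntegrable (by fun_prop) _ _)
  rw [intervalIntegral.integral_eq_sub_of_hasDerivAt (fun z _ => hderiv z) hint]
  have eL : cexp ((m : ℂ) * π * I * (L : ℂ)) = cexp ((((m * L * π : ℝ)) : ℂ) * I) := by
    congr 1; push_cast; ring
  rw [eL]
  unfold Pz
  simp only [Complex.ofReal_zero, mul_zero, Complex.exp_zero, mul_one, add_zero]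

/-! ### Interval primitives: `xπ`, `qx`, `1/x`, `1/(xπ)`, `e^{xπi}` for `x` in an interval -/

/-- Enclosure of `xπ` for `x ∈ X`. [folklore] -/
def mulPiFI (X : FI) : FI := X.mul FI.pi

/-- `xπ ∈ mulPiFI X`. [cite: Moore1966, Theorem 3.1] -/
theorem mem_mulPiFI {x : ℝ} {X : FI} (hx : FI.mem x X) : FI.mem (x * π) (mulPiFI X) :=
  FI.mem_mul hx FI.mem_pi

/-- Enclosure of `q·x` for `x ∈ X` and a rational `q`. [folklore] -/
def scaleRatFI (X : FI) (q : ℚ) : FI := (X.mulInt q.num).divNat q.den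

/-- `q·x ∈ scaleRatFI X q`. [cite: Moore1966, Theorem 3.1] -/
theorem mem_scaleRatFI {x : ℝ} {X : FI} (hx : FI.mem x X) (q : ℚ) :
    FI.mem ((q : ℝ) * x) (scaleRatFI X q) := by
  have h := FI.mem_divNat (FI.mem_mulInt hx q.num) q.den_pos
  have e : x * (q.num : ℝ) / (q.den : ℝ) = (q : ℝ) * x := by
    rw [Rat.cast_def q]; ring
  rw [e] at h; exact h

/-- Enclosure of `1/x` for `x ∈ X`, `X` of definite sign (junk if the flag `recipOK X` is false).
[folklore] -/
def recipFI (X : FI) : FI :=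
  if 0 < X.lo then (FI.divPos (FI.ofInt 1) X).getD (FI.ofInt 0)
  else ((FI.divPos (FI.ofInt 1) X.neg).getD (FI.ofInt 0)).neg

/-- validity flag for `recipFI` [folklore] -/
def recipOK (X : FI) : Bool :=
  if 0 < X.lo then (FI.divPos (FI.ofInt 1) X).isSome else (FI.divPos (FI.ofInt 1) X.neg).isSome

/-- `1/x ∈ recipFI X` whenever the flag is set. [cite: Moore1966, Theorem 3.1] -/
theorem mem_recipFI {x : ℝ} {X : FI} (h : recipOK X = true) (hx : FI.mem x X) :
    FI.mem (1 / x) (recipFI X) := by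
  unfold recipOK at h
  unfold recipFI
  by_cases hs : 0 < X.lo
  · rw [if_pos hs] at h ⊢
    cases hK : FI.divPos (FI.ofInt 1) X with
    | none => rw [hK] at h; simp at h
    | some K => simpa using FI.mem_divPos hK FI.mem_one hx
  · rw [if_neg hs] at h ⊢
    cases hK : FI.divPos (FI.ofInt 1) X.neg with
    | none => rw [hK] at h; simp at h
    | some K =>
      have h1 := FI.mem_neg (FI.mem_divPos hK FI.mem_one (FI.mem_neg hx))
      rw [div_neg, neg_neg] at h1
      simpa using h1

/-- Enclosure of `1/(xπ)` for `x ∈ X` (junk if the flag is false). [folklore] -/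
def recipMulPiFI (X : FI) : FI := recipFI (mulPiFI X)
/-- validity flag for `recipMulPiFI` [folklore] -/
def recipMulPiOK (X : FI) : Bool := recipOK (mulPiFI X)

/-- `1/(xπ) ∈ recipMulPiFI X` whenever the flag is set. [cite: Moore1966, Theorem 3.1] -/
theorem mem_recipMulPiFI {x : ℝ} {X : FI} (h : recipMulPiOK X = true) (hx : FI.mem x X) :
    FI.mem (invMulPi x) (recipMulPiFI X) :=
  mem_recipFI h (mem_mulPiFI hx)

/-- Enclosure of `e^{xπi}` for `x ∈ X` (junk if the flag `expIpiFIOK X` is false). [folklore] -/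
def expIpiFI (X : FI) : CB := (CB.expI (mulPiFI X)).getD (CB.ofInt 0)
/-- validity flag for `expIpiFI` [folklore] -/
def expIpiFIOK (X : FI) : Bool := (CB.expI (mulPiFI X)).isSome

/-- `e^{xπi} ∈ expIpiFI X` whenever the flag is set. [cite: Moore1966, Theorem 3.1] -/
theorem mem_expIpiFI {x : ℝ} {X : FI} (h : expIpiFIOK X = true) (hx : FI.mem x X) :
    CB.mem (cexp ((((x * π : ℝ)) : ℂ) * I)) (expIpiFI X) := by
  unfold expIpiFIOK at h
  unfold expIpiFI
  cases hY : CB.expI (mulPiFI X) with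
  | none => rw [hY] at h; simp at h
  | some Y => simpa using CB.mem_expI hY (mem_mulPiFI hx)

/- Keep the interval primitives opaque to the elaborator's unifier (cf. `Section8Certificate`):
the `mem` lemmas are applied purely syntactically. The kernel (`decide +kernel`) is unaffected. -/
attribute [local irreducible] CB.add CB.sub CB.mul CB.neg CB.conj CB.mulFI CB.mulI CB.mulInt
  CB.ofFI CB.ofInt CB.normSqFI CB.expI FI.add FI.sub FI.mul FI.neg FI.mulInt FI.divNat FI.divPos
  FI.ofRat FI.ofInt FI.pi qCB piMul expIpi overPiFI piISq mulPiFI scaleRatFI recipFI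
  recipMulPiFI expIpiFI

/-! ### The antiderivative boxes at real arguments -/

/-- `P₀(u) ∈ P0B … U` for real `u ∈ U`. [cite: Moore1966, Theorem 3.1] -/
theorem mem_P0B {q0 q1 q2 : ℂ} {Q0 Q1 Q2 : CB} {u : ℝ} {U : FI}
    (h0 : CB.mem q0 Q0) (h1 : CB.mem q1 Q1) (h2 : CB.mem q2 Q2) (hu : FI.mem u U) :
    CB.mem (P0 q0 q1 q2 u) (P0B Q0 Q1 Q2 U) := by
  unfold P0 P0B
  apply_rules [CB.mem_add, CB.mem_mul, CB.mem_neg, CB.mem_mulI, CB.mem_mulFI,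
    CB.mem_mulInt, FI.mem_mul]

/-- `P₁(u) ∈ P1B … U` for real `u ∈ U`. [cite: Moore1966, Theorem 3.1] -/
theorem mem_P1B {q1 q2 : ℂ} {Q1 Q2 : CB} {u : ℝ} {U : FI}
    (h1 : CB.mem q1 Q1) (h2 : CB.mem q2 Q2) (hu : FI.mem u U) :
    CB.mem (P1 q1 q2 u) (P1B Q1 Q2 U) := by
  unfold P1 P1B
  apply_rules [CB.mem_add, CB.mem_mul, CB.mem_neg, CB.mem_mulI, CB.mem_mulFI,
    CB.mem_mulInt, FI.mem_mul]

/-- `P₂(u) ∈ P2B … U` for real `u ∈ U`. [cite: Moore1966, Theorem 3.1] -/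
theorem mem_P2B {q2 : ℂ} {Q2 : CB} {u : ℝ} {U : FI} (h2 : CB.mem q2 Q2) (hu : FI.mem u U) :
    CB.mem (P2 q2 u) (P2B Q2 U) := by
  unfold P2 P2B
  apply_rules [CB.mem_neg, CB.mem_mulI, CB.mem_mulFI]

/-- `P(u, z) ∈ PzB … U Z` for real `u ∈ U`, `z ∈ Z`. [cite: Moore1966, Theorem 3.1] -/
theorem mem_PzB {q0 q1 q2 : ℂ} {Q0 Q1 Q2 : CB} {u z : ℝ} {U Z : FI}
    (h0 : CB.mem q0 Q0) (h1 : CB.mem q1 Q1) (h2 : CB.mem q2 Q2) (hu : FI.mem u U)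
    (hz : FI.mem z Z) : CB.mem (Pz q0 q1 q2 u z) (PzB Q0 Q1 Q2 U Z) := by
  have hP0 := mem_P0B h0 h1 h2 hu
  have hP1 := mem_P1B h1 h2 hu
  have hP2 := mem_P2B h2 hu
  unfold Pz PzB
  apply_rules [CB.mem_add, CB.mem_mulFI, FI.mem_mul]

/-- Soundness of `polyIntB` at a REAL length `l ∈ L` (`mem_polyIntB` is the rational case).
[cite: Moore1966, Theorem 3.1] -/
theorem mem_polyIntB_real {q0 q1 q2 : ℂ} {Q0 Q1 Q2 : CB} {l : ℝ} {L : FI}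
    (h0 : CB.mem q0 Q0) (h1 : CB.mem q1 Q1) (h2 : CB.mem q2 Q2) (hl : FI.mem l L) :
    CB.mem (polyInt q0 q1 q2 l) (polyIntB Q0 Q1 Q2 L) := by
  unfold polyInt polyIntB
  apply_rules [CB.mem_add, CB.mem_mulFI, FI.mem_mul, FI.mem_ofRat]

/-! ### Box mirrors of the exponential–quadratic integral with interval length (and frequency) -/

/-- Box mirror of `expQuadInt q₀ q₁ q₂ m l` for a RATIONAL frequency `m` and a length `l` in the
interval `L`. [folklore] -/
@[irreducible] def expQuadIntBL (Q0 Q1 Q2 : CB) (m : ℚ) (L : FI) : CB :=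
  ((PzB Q0 Q1 Q2 (overPiFI m⁻¹) L).mul (expIpiFI (scaleRatFI L m))).sub
    (P0B Q0 Q1 Q2 (overPiFI m⁻¹))

/-- Soundness of `expQuadIntBL`. [cite: Moore1966, Theorem 3.1] -/
theorem mem_expQuadIntBL {q0 q1 q2 : ℂ} {Q0 Q1 Q2 : CB} {m : ℚ} {l : ℝ} {L : FI}
    (h0 : CB.mem q0 Q0) (h1 : CB.mem q1 Q1) (h2 : CB.mem q2 Q2) (hl : FI.mem l L)
    (hU : overPiOK m⁻¹ = true) (hE : expIpiFIOK (scaleRatFI L m) = true) :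
    CB.mem (expQuadInt q0 q1 q2 m l) (expQuadIntBL Q0 Q1 Q2 m L) := by
  have hu := mem_overPiFI hU
  have he := mem_expIpiFI hE (mem_scaleRatFI hl m)
  have hPz := mem_PzB h0 h1 h2 hu hl
  have hP0 := mem_P0B h0 h1 h2 hu
  unfold expQuadInt expQuadIntBL
  apply_rules [CB.mem_sub, CB.mem_mul]

/-- Box mirror of `expQuadIntR q₀ q₁ q₂ m l` for a frequency `m ∈ M` and a length `l ∈ L`
(both intervals). [folklore] -/
@[irreducible] def expQuadIntBR (Q0 Q1 Q2 : CB) (M L : FI) : CB :=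
  ((PzB Q0 Q1 Q2 (recipMulPiFI M) L).mul (expIpiFI (M.mul L))).sub
    (P0B Q0 Q1 Q2 (recipMulPiFI M))

/-- Soundness of `expQuadIntBR`. [cite: Moore1966, Theorem 3.1] -/
theorem mem_expQuadIntBR {q0 q1 q2 : ℂ} {Q0 Q1 Q2 : CB} {m l : ℝ} {M L : FI}
    (h0 : CB.mem q0 Q0) (h1 : CB.mem q1 Q1) (h2 : CB.mem q2 Q2) (hm : FI.mem m M)
    (hl : FI.mem l L) (hR : recipMulPiOK M = true) (hE : expIpiFIOK (M.mul L) = true) :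
    CB.mem (expQuadIntR q0 q1 q2 m l) (expQuadIntBR Q0 Q1 Q2 M L) := by
  have hu := mem_recipMulPiFI hR hm
  have he := mem_expIpiFI hE (FI.mem_mul hm hl)
  have hPz := mem_PzB h0 h1 h2 hu hl
  have hP0 := mem_P0B h0 h1 h2 hu
  unfold expQuadIntR expQuadIntBR
  apply_rules [CB.mem_sub, CB.mem_mul]

/-! ### The §8 integrals with the printed profiles at interval lengths and shifts -/

/-- Box mirror of `FGint a k r₀ r₁ b l`, `l ∈ L`. [folklore] -/
@[irreducible] def FGintBL (a k r0 r1 b : ℚ) (L : FI) : CB :=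
  (expQuadIntBL (qCB r0) ((((qCB r0).mul (qCB a)).mulFI FI.pi).mulI) (CB.ofInt 0) k L).add
    (polyIntB (qCB r1) (((((qCB a).mul (qCB r1)).add (qCB b)).mulFI FI.pi).mulI)
      (((qCB a).mul (qCB b)).mul piISq) L)

/-- Soundness of `FGintBL`. [cite: Moore1966, Theorem 3.1] -/
theorem mem_FGintBL {a k r0 r1 b : ℚ} {l : ℝ} {L : FI} (hl : FI.mem l L)
    (hU : overPiOK k⁻¹ = true) (hE : expIpiFIOK (scaleRatFI L k) = true) :
    CB.mem (FGint a k r0 r1 b l) (FGintBL a k r0 r1 b L) := by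
  unfold FGint FGintBL
  apply_rules [mem_expQuadIntBL, mem_polyIntB_real, CB.mem_add, CB.mem_mul, CB.mem_mulI,
    CB.mem_mulFI, FI.mem_pi, mem_qCB, mem_zeroCB, mem_piISq]

/-- box of `r₁ + bπis`, `s ∈ S` [folklore] -/
@[irreducible] def shiftRBI (r1 b : ℚ) (S : FI) : CB :=
  (qCB r1).add ((((qCB b).mulFI FI.pi).mulI).mulFI S)
/-- box of `1 + aπis`, `s ∈ S` [folklore] -/
@[irreducible] def shiftUBI (a : ℚ) (S : FI) : CB :=
  (CB.ofInt 1).add ((((qCB a).mulFI FI.pi).mulI).mulFI S)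

/-- `r₁ + bπis ∈ shiftRBI r₁ b S`. [cite: Moore1966, Theorem 3.1] -/
theorem mem_shiftRBI (r1 b : ℚ) {s : ℝ} {S : FI} (hs : FI.mem s S) :
    CB.mem ((r1 : ℂ) + b * π * I * (s : ℝ)) (shiftRBI r1 b S) := by
  unfold shiftRBI
  apply_rules [CB.mem_add, CB.mem_mulI, CB.mem_mulFI, FI.mem_pi, mem_qCB]

/-- `1 + aπis ∈ shiftUBI a S`. [cite: Moore1966, Theorem 3.1] -/
theorem mem_shiftUBI (a : ℚ) {s : ℝ} {S : FI} (hs : FI.mem s S) :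
    CB.mem ((1 : ℂ) + a * π * I * (s : ℝ)) (shiftUBI a S) := by
  unfold shiftUBI
  apply_rules [CB.mem_add, CB.mem_mulI, CB.mem_mulFI, FI.mem_pi, mem_qCB, mem_oneCB]

/-- Box mirror of `FGXint a k r₀ r₁ b k' l s`, `l ∈ L`, `s ∈ S`. [folklore] -/
@[irreducible] def FGXintBL (a k r0 r1 b k' : ℚ) (L S : FI) : CB :=
  (expQuadIntBL (qCB r0) ((((qCB r0).mul (qCB a)).mulFI FI.pi).mulI) (CB.ofInt 0) k L).add
    ((expIpiFI (scaleRatFI S (-k'))).mul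
      (expQuadIntBL (shiftRBI r1 b S)
        (((((qCB a).mul (shiftRBI r1 b S)).add (qCB b)).mulFI FI.pi).mulI)
        (((qCB a).mul (qCB b)).mul piISq) (k - k') L))

/-- Soundness of `FGXintBL`. [cite: Moore1966, Theorem 3.1] -/
theorem mem_FGXintBL {a k r0 r1 b k' : ℚ} {l s : ℝ} {L S : FI} (hl : FI.mem l L)
    (hs : FI.mem s S) (hU : overPiOK k⁻¹ = true) (hE : expIpiFIOK (scaleRatFI L k) = true)
    (hU' : overPiOK (k - k')⁻¹ = true) (hE' : expIpiFIOK (scaleRatFI L (k - k')) = true)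
    (hS : expIpiFIOK (scaleRatFI S (-k')) = true) :
    CB.mem (FGXint a k r0 r1 b k' l s) (FGXintBL a k r0 r1 b k' L S) := by
  have he := mem_expIpiFI hS (mem_scaleRatFI hs (-k'))
  rw [show ((((-k' : ℚ) : ℝ) * s) * π : ℝ) = (-(k' : ℝ)) * s * π by push_cast; ring] at he
  have hR := mem_shiftRBI r1 b hs
  unfold FGXint FGXintBL
  apply_rules [mem_expQuadIntBL, CB.mem_add, CB.mem_mul, CB.mem_mulI, CB.mem_mulFI,
    FI.mem_pi, mem_qCB, mem_zeroCB, mem_piISq]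

/-- Box mirror of `FGYint a k r₀ r₁ b k' l s`, `l ∈ L`, `s ∈ S`. [folklore] -/
@[irreducible] def FGYintBL (a k r0 r1 b k' : ℚ) (L S : FI) : CB :=
  (expIpiFI (scaleRatFI S k)).mul
    ((expQuadIntBL ((qCB r0).mul (shiftUBI a S)) ((((qCB r0).mul (qCB a)).mulFI FI.pi).mulI)
        (CB.ofInt 0) k L).add
      (expQuadIntBL ((shiftUBI a S).mul (qCB r1))
        (((((shiftUBI a S).mul (qCB b)).add ((qCB a).mul (qCB r1))).mulFI FI.pi).mulI)
        (((qCB a).mul (qCB b)).mul piISq) (k - k') L))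

/-- Soundness of `FGYintBL`. [cite: Moore1966, Theorem 3.1] -/
theorem mem_FGYintBL {a k r0 r1 b k' : ℚ} {l s : ℝ} {L S : FI} (hl : FI.mem l L)
    (hs : FI.mem s S) (hU : overPiOK k⁻¹ = true) (hE : expIpiFIOK (scaleRatFI L k) = true)
    (hU' : overPiOK (k - k')⁻¹ = true) (hE' : expIpiFIOK (scaleRatFI L (k - k')) = true)
    (hS : expIpiFIOK (scaleRatFI S k) = true) :
    CB.mem (FGYint a k r0 r1 b k' l s) (FGYintBL a k r0 r1 b k' L S) := by
  have he := mem_expIpiFI hS (mem_scaleRatFI hs k)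
  have hUm := mem_shiftUBI a hs
  unfold FGYint FGYintBL
  apply_rules [mem_expQuadIntBL, CB.mem_add, CB.mem_mul, CB.mem_mulI, CB.mem_mulFI,
    FI.mem_pi, mem_qCB, mem_zeroCB, mem_piISq]

/-! ### Coordinates of a rational box as intervals -/

/-- Coordinate `i` of the rational box `B` as a fixed-point interval (outward rounded). [folklore] -/
def boxFI (B : Box) (i : ℕ) : FI := FI.ofRatRat (B.ivl i).1 (B.ivl i).2

/-- A point of the box lies coordinatewise in `boxFI`. [cite: Moore1966, Theorem 3.1] -/
theorem mem_boxFI {B : Box} {x : ℕ → ℝ} (hx : B.mem x) (i : ℕ) : FI.mem (x i) (boxFI B i) :=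
  FI.mem_ofRatRat (hx i).1 (hx i).2

/-- The point box of a rational parameter vector (every coordinate a degenerate interval): the
format in which a POINT certificate is a box certificate. [folklore] -/
def pointBox (θ : List ℚ) : Box := θ.map fun q => (q, q)

/-- The rational point lies in its point box. [cite: Moore1966, Theorem 3.1] -/
theorem mem_pointBox (θ : List ℚ) : (pointBox θ).mem fun i => ((θ.getD i 0 : ℚ) : ℝ) := by
  intro i
  have h : (pointBox θ).ivl i = (θ.getD i 0, θ.getD i 0) := by
    simp only [Box.ivl, pointBox, List.getD_eq_getElem?_getD, List.getElem?_map]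
    cases θ[i]? <;> rfl
  simp only [h, le_refl, and_self]

end Literature.NumberTheory.LFunctions.Zhang2022
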